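import Literature.NumberTheory.EllipticCurves.PadicSigmaSqUniquenessProofs
import Literature.NumberTheory.EllipticCurves.PadicSigmaVariableChangeProofs
import HarnessLib

/-!
# The sigma-squared pair under `p`-integral changes of variables; transport to every `ℚ₂`-model
# isomorphic to `X₀(49) ⊗ ℚ₂` (proofs only)

Topic `NumberTheory/EllipticCurves` (theorems only; no definition, no named fact). The squared twin of
`IsMazurTateSigmaPair.of_variableChange` (`PadicSigmaVariableChangeProofs.lean`): for a `p`-integral
`V/ℚ_p` and a change of variables `vc = (u, r, s, t)` with `u ∈ ℤ_pˣ`, `r, s, t ∈ ℤ_p`, a sigma-squared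
pair `(Σ', c')` of `vc • V` (`PadicSigmaSq.lean`) yields the sigma-squared pair
**`(u⁻²·Σ' ∘ θ, u²c' - r)`** of `V`, `θ = formalVariableChange vc` (`z' = u z + ⋯` read through the
isomorphism) — `IsMazurTateSigmaSqPair.of_variableChange`. Proof: `Σ' = σ'²` for a normalised odd
solution `σ'` of the sigma equation of `vc • V` (`exists_sq_eq`; `σ'` itself need not be integral),
the tree transports `σ'` (`IsFormallyOdd.variableChange_subst`, `SatisfiesSigmaODE.variableChange_subst`),
and integrality of `u⁻²·Σ' ∘ θ` is that of `Σ'` and `θ ∈ ℤ_p⟦z⟧` (`isPadicInt_formalVariableChange`).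
With the binder-free uniqueness at `p = 2` for `a₁` odd (`IsMazurTateSigmaSqPair.unique_two_of_norm_a₁_eq_one`)
this pins `padicSigmaSq` of EVERY `2`-integral model `V/ℚ₂` with `a₁ ∈ ℤ₂ˣ` that is `ℤ₂`-isomorphic to a
model carrying a sigma-squared pair (`padicSigmaSq_eq_of_variableChange_two`), in particular of every
`V` with `vc • V = X₀(49) ⊗ ℚ₂`: **`Σ₂(V) = u⁻²·σ_CM² ∘ θ`, `c₂(V) = -r`** (`padicSigmaSq_eq_of_smul_eq_cm7_two`)
— (L1) at `2` for all `ℚ₂`-forms of `X₀(49)` `ℤ₂`-isomorphic to the minimal model, e.g. the quadratic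
twists `49a1^{(D)} ⊗ ℚ₂` with `D ≡ 1 (mod 8)` once the isomorphism is supplied (Summit-side consumers own
the twist bookkeeping; nothing about twists is asserted here).

## References
* [Mazur–Tate 1991] §3 (functoriality of `σ_{(E,ω)}`), Thm. 3.1. [cite: MazurTate1991, Thm. 3.1]
* [Mazur–Stein–Tate 2006] Thm. 1.3 and §1 (`c` has weight `2`). [cite: MazurSteinTate2006, Thm. 1.3]
* [Silverman 2005] §5 Rem. 2 (the squared sigma function at `p = 2`). [cite: Silverman2005DivPoly, §5 Rem. 2]
* [Perrin-Riou 1984] Ch. III §1.2 («l'invariance de θ par rapport au modèle», p. 53). [cite: Perrinriou1984, Ch. III §1.2 Lemme 2]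
-/

noncomputable section

open PowerSeries Literature.NumberTheory.EllipticCurves

namespace WeierstrassCurve

variable {p : ℕ} [Fact p.Prime] (V : WeierstrassCurve ℚ_[p]) (vc : VariableChange ℚ_[p])

variable {V vc} in
/-- **The sigma-squared pair transports along a `p`-integral change of variables**: if `(Σ', c')` is a
sigma-squared pair of `vc • V` (`u ∈ ℤ_pˣ`, `r, s, t ∈ ℤ_p`), then `(u⁻²·Σ' ∘ θ, u²c' - r)` is a
sigma-squared pair of `V`. [Mazur–Tate 1991, §3; Mazur–Stein–Tate 2006, Thm. 1.3, §1; Silverman 2005,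
§5 Rem. 2] [cite: MazurSteinTate2006, Thm. 1.3] [cite: Silverman2005DivPoly, §5 Rem. 2] -/
theorem IsMazurTateSigmaSqPair.of_variableChange [V.IsIntegral ℤ_[p]] (hu : ‖(vc.u : ℚ_[p])‖ = 1)
    (hr : ‖vc.r‖ ≤ 1) (hs : ‖vc.s‖ ≤ 1) (ht : ‖vc.t‖ ≤ 1) {Sq' : ℚ_[p]⟦X⟧} {c' : ℚ_[p]}
    (h : (vc • V).IsMazurTateSigmaSqPair Sq' c') :
    V.IsMazurTateSigmaSqPair
      (C ((vc.u⁻¹ : ℚ_[p]ˣ) : ℚ_[p]) ^ 2 * Sq'.subst (V.formalVariableChange vc))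
      ((vc.u : ℚ_[p]) ^ 2 * c' - vc.r) := by
  obtain ⟨σ', h0, h1, hodd, hODE, hSq⟩ := h.exists_sq_eq
  have hθs := V.hasSubst_formalVariableChange vc
  have hθ := V.isPadicInt_formalVariableChange vc hu.le hr hs ht
  have hui : ‖((vc.u⁻¹ : ℚ_[p]ˣ) : ℚ_[p])‖ ≤ 1 := by
    rw [Units.val_inv_eq_inv_val, norm_inv, hu, inv_one]
  set σ : ℚ_[p]⟦X⟧ := C ((vc.u⁻¹ : ℚ_[p]ˣ) : ℚ_[p]) * σ'.subst (V.formalVariableChange vc) with hσ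
  have hσ0 : constantCoeff σ = 0 := by
    rw [hσ, map_mul, V.constantCoeff_subst_formalVariableChange vc h0, mul_zero]
  have hσ1 : coeff 1 σ = 1 := by
    rw [hσ, coeff_C_mul, V.coeff_one_subst_formalVariableChange vc h1, Units.inv_mul]
  have hσodd : V.IsFormallyOdd σ := hodd.variableChange_subst _
  have hσODE : V.SatisfiesSigmaODE σ ((vc.u : ℚ_[p]) ^ 2 * c' - vc.r) := hODE.variableChange_subst h0 h1
  have hsq : C ((vc.u⁻¹ : ℚ_[p]ˣ) : ℚ_[p]) ^ 2 * Sq'.subst (V.formalVariableChange vc) = σ ^ 2 := by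
    rw [hSq, subst_pow hθs, hσ]; ring
  have hint : IsPadicInt (C ((vc.u⁻¹ : ℚ_[p]ˣ) : ℚ_[p]) ^ 2 * Sq'.subst (V.formalVariableChange vc)) :=
    ((IsPadicInt.powerSeries_C hui).pow 2).mul (h.isPadicInt.powerSeries_subst hθ hθs)
  rw [hsq] at hint ⊢
  exact
    { constantCoeff_eq := by rw [map_pow, hσ0, zero_pow two_ne_zero]
      coeff_one_eq := by
        rw [pow_two, coeff_one_mul_eq, coeff_zero_eq_constantCoeff_apply, hσ0]; ring
      coeff_two_eq := by
        rw [pow_two, coeff_two_mul_eq, coeff_zero_eq_constantCoeff_apply, hσ0, hσ1]; ring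
      norm_coeff_le := isPadicInt_iff_coeff.mp hint
      even := hσodd.sq
      ode := hσODE.sq hσ0 hσ1 }

variable {V vc} in
/-- Hence **existence of a sigma-squared pair transports** from `vc • V` to `V`.
[Mazur–Stein–Tate 2006, Thm. 1.3; Silverman 2005, §5 Rem. 2] [cite: Silverman2005DivPoly, §5 Rem. 2] -/
theorem exists_isMazurTateSigmaSqPair_of_variableChange [V.IsIntegral ℤ_[p]]
    (hu : ‖(vc.u : ℚ_[p])‖ = 1) (hr : ‖vc.r‖ ≤ 1) (hs : ‖vc.s‖ ≤ 1) (ht : ‖vc.t‖ ≤ 1)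
    (hex : ∃ Sq' : ℚ_[p]⟦X⟧, ∃ c', (vc • V).IsMazurTateSigmaSqPair Sq' c') :
    ∃ Sq : ℚ_[p]⟦X⟧, ∃ c, V.IsMazurTateSigmaSqPair Sq c := by
  obtain ⟨Sq', c', h⟩ := hex
  exact ⟨_, _, h.of_variableChange hu hr hs ht⟩

/-! ### `p = 2`: `padicSigmaSq` of every `ℤ₂`-isomorphic model, `a₁` odd -/

section Two

variable (V : WeierstrassCurve ℚ_[2]) (vc : VariableChange ℚ_[2])

variable {V vc} in
/-- **`Σ₂` and `c₂` of a `2`-integral `V/ℚ₂` with `a₁ ∈ ℤ₂ˣ` from ANY sigma-squared pair of a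
`ℤ₂`-isomorphic model `vc • V`**: `padicSigmaSq V = u⁻²·Σ' ∘ θ`, `padicSigmaSqConst V = u²c' - r`
(transport + binder-free uniqueness at `2`). [Mazur–Tate 1991, Thm. 3.1; Silverman 2005, §5 Rem. 2]
[cite: MazurTate1991, Thm. 3.1] [cite: Silverman2005DivPoly, §5 Rem. 2] -/
theorem padicSigmaSq_eq_of_variableChange_two [V.IsIntegral ℤ_[2]] (ha : ‖V.a₁‖ = 1)
    (hu : ‖(vc.u : ℚ_[2])‖ = 1) (hr : ‖vc.r‖ ≤ 1) (hs : ‖vc.s‖ ≤ 1) (ht : ‖vc.t‖ ≤ 1)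
    {Sq' : ℚ_[2]⟦X⟧} {c' : ℚ_[2]} (h : (vc • V).IsMazurTateSigmaSqPair Sq' c') :
    V.padicSigmaSq = C ((vc.u⁻¹ : ℚ_[2]ˣ) : ℚ_[2]) ^ 2 * Sq'.subst (V.formalVariableChange vc) ∧
      V.padicSigmaSqConst = (vc.u : ℚ_[2]) ^ 2 * c' - vc.r := by
  have hV := h.of_variableChange hu hr hs ht
  have hpad := isMazurTateSigmaSqPair_padicSigmaSq (Or.inr ⟨_, _, hV⟩)
  exact hpad.unique_two_of_norm_a₁_eq_one V ha hV

variable {V vc} in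
/-- **(L1) at `2` for every `ℤ₂`-form of `X₀(49)`**: if `vc • V = X₀(49) ⊗ ℚ₂` (`V` a `2`-integral
model with `a₁` odd, `vc` `2`-integral with `u ∈ ℤ₂ˣ`) then `Σ₂(V) = u⁻²·σ_CM² ∘ θ` and `c₂(V) = -r`,
where `σ_CM` is any (= the) normalised odd formal solution of `x = -D(Dσ/σ)` on `[1,-1,0,-2,-1]`
(Perrin-Riou's `σ_v`, `s₂ = 1/4`). [Perrin-Riou 1984, Ch. III §1.2 (Lemme 2; invariance par rapport au
modèle, p. 53); Mazur–Tate 1991, Thm. 3.1] [cite: Perrinriou1984, Ch. III §1.2 Lemme 2] -/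
theorem padicSigmaSq_eq_of_smul_eq_cm7_two [V.IsIntegral ℤ_[2]] (ha : ‖V.a₁‖ = 1)
    (hu : ‖(vc.u : ℚ_[2])‖ = 1) (hr : ‖vc.r‖ ≤ 1) (hs : ‖vc.s‖ ≤ 1) (ht : ‖vc.t‖ ≤ 1)
    (hV : vc • V = cm7.baseChange ℚ_[2]) {σ : ℚ_[2]⟦X⟧} (hσ0 : constantCoeff σ = 0)
    (hσ1 : coeff 1 σ = 1) (hodd : (cm7.baseChange ℚ_[2]).IsFormallyOdd σ)
    (hODE : (cm7.baseChange ℚ_[2]).SatisfiesSigmaODE σ 0) :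
    V.padicSigmaSq = C ((vc.u⁻¹ : ℚ_[2]ˣ) : ℚ_[2]) ^ 2 * (σ ^ 2).subst (V.formalVariableChange vc) ∧
      V.padicSigmaSqConst = -vc.r := by
  have h := cm7_isMazurTateSigmaSqPair_sq_two hσ0 hσ1 hodd hODE
  rw [← hV] at h
  have e := padicSigmaSq_eq_of_variableChange_two ha hu hr hs ht h
  rw [mul_zero, zero_sub] at e
  exact e

variable {V vc} in
/-- … and such a `V` carries exactly one sigma-squared pair (binder-free).
[cite: MazurTate1991, Thm. 3.1] [cite: Silverman2005DivPoly, §5 Rem. 2] -/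
theorem existsUnique_isMazurTateSigmaSqPair_of_smul_eq_cm7_two [V.IsIntegral ℤ_[2]] (ha : ‖V.a₁‖ = 1)
    (hu : ‖(vc.u : ℚ_[2])‖ = 1) (hr : ‖vc.r‖ ≤ 1) (hs : ‖vc.s‖ ≤ 1) (ht : ‖vc.t‖ ≤ 1)
    (hV : vc • V = cm7.baseChange ℚ_[2]) :
    ∃! Sc : ℚ_[2]⟦X⟧ × ℚ_[2], V.IsMazurTateSigmaSqPair Sc.1 Sc.2 := by
  have hex : ∃ Sq' : ℚ_[2]⟦X⟧, ∃ c', (vc • V).IsMazurTateSigmaSqPair Sq' c' := by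
    obtain ⟨σ, -, -, -, -, h⟩ := cm7_exists_isMazurTateSigmaSqPair_sq_two
    rw [hV]; exact ⟨σ ^ 2, 0, h⟩
  exact V.existsUnique_isMazurTateSigmaSqPair_of_exists (V.unbounded_formalLog_two_of_norm_a₁_eq_one ha)
    (exists_isMazurTateSigmaSqPair_of_variableChange hu hr hs ht hex)

end Two

end WeierstrassCurve
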